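import Summits.CriticalPhenomena.PercolationContinuityZ3.Theorems.Transplant.SkelPhiFaceNumsYRun
import HarnessLib

/-!
# N1 ({±1} node), (F) inner route, (L-F1) under ruling (ii): THE y′-FACE CLEARANCE FLOORS FROM ONE v-FREE BRIDGE FLOOR

The along y′-run of a y′-face is seed-clear on the HOP SIDE `σ_h := σ·sgn⁺ v_α` (p1-g13's recession lemma, lane INBOX 2026-08-22T01:09:22Z;
`clear_alongY_of_floors`, `SkelPhiFaceRouteNumbersY6`) as soon as, per region `k ≤ Nr`, the transverse floor (`σ_h = σ`: `yBoxLoT k + σ·yL 0 > M`)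
resp. ceiling (`σ_h = −σ`: `yBoxHiT k + σ·yL 0 < −M`) clears the seed box `M`.  With the ORIGIN OF RECORD `σ·yL 0 = s_h·(c_lo + n) + v`
(`s_h = ±1` the relative sign; stmt-g15 `KS.yLFs`, `yLFs_zero`) both families of `Nr + 1` inequalities follow from the ONE v-free floor
`M + n + (Nr+1)·R′ < c_lo` (= stmt-g15's `KS.clearF`, c := Nr+1 bridge widths; p5-g10 2026-08-22T01:39:50Z ✓): this file proves exactly that
reduction, so the numbers maker (`hp-8`'s `faceRunNumsY4_mk`) discharges `hclrP/hclrM` by one line each.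
* `Skelφ.yBoxLoT_add_origin`, `Skelφ.yBoxHiT_add_origin` (closed forms at the origin of record); **`Skelφ.hclrP_of_clearF`** (`0 ≤ v`),
  **`Skelφ.hclrM_of_clearF`** (`v ≤ 0`).
builds on p205010 (kernel theorem, internal audit signed; external expert review pending) — nothing in this file uses p205010; no claim about the open node.
Lane `prim-bschramm`, seat `prim-bschramm-p1` (gen 13); helper file (`--supports stmt-CriticalPhenomena-4575 --as helper`).
[cite: KozmaNitzan2024, §4 Lemma 11 (pp. 22–23)] [cite: MartineauTassion2017, §4.3 Lemma 4.2]
-/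

namespace Summit.CriticalPhenomena.PercolationContinuityZ3.Theorems.Transplant

namespace Skelφ

/-- The transverse floor of region `k` at the origin of record on the floor side (`σ·yL 0 = c_lo + n + v`, `|v| ≤ n`):
`yBoxLoT k + σ·yL 0 = c_lo − n + k·v − (k+1)·R′`. [folklore] -/
theorem yBoxLoT_add_origin {n : ℕ} {v : ℤ} (hv : |v| ≤ n) (R' k : ℕ) {clo a : ℤ} (ha : a = clo + n + v) :
    yBoxLoT n v R' k + a = clo - n + (k : ℤ) * v - ((k : ℤ) + 1) * R' := by
  rw [abs_le] at hv
  have h1 : ((((n : ℤ) + v).toNat : ℕ) : ℤ) = n + v := Int.toNat_of_nonneg (by linarith)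
  unfold yBoxLoT
  rw [h1, ha]; ring

/-- The transverse ceiling of region `k` at the origin of record on the ceiling side (`σ·yL 0 = −(c_lo + n) + v`, `|v| ≤ n`):
`yBoxHiT k + σ·yL 0 = −(c_lo − n − k·v − (k+1)·R′)`. [folklore] -/
theorem yBoxHiT_add_origin {n : ℕ} {v : ℤ} (hv : |v| ≤ n) (R' k : ℕ) {clo a : ℤ} (ha : a = -(clo + n) + v) :
    yBoxHiT n v R' k + a = -(clo - n - (k : ℤ) * v - ((k : ℤ) + 1) * R') := by
  rw [abs_le] at hv
  have h1 : ((((n : ℤ) - v).toNat : ℕ) : ℤ) = n - v := Int.toNat_of_nonneg (by linarith)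
  unfold yBoxHiT
  rw [h1, ha]; ring

/-- **`hclrP` from the v-free bridge floor** (hop side `s_h = 1`, i.e. `0 ≤ v`): `M + n + (N+1)·R′ < c_lo` gives
`M < yBoxLoT k + σ·yL 0` for every `k ≤ N`. [cite: KozmaNitzan2024, §4 Lemma 11 (p. 22)] -/
theorem hclrP_of_clearF {n : ℕ} {v : ℤ} (hv : |v| ≤ n) (hv0 : 0 ≤ v) (R' N : ℕ) {clo a M : ℤ} (ha : a = clo + n + v)
    (hF : M + n + ((N : ℤ) + 1) * R' < clo) : ∀ k ≤ N, M < yBoxLoT n v R' k + a := by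
  intro k hk
  rw [yBoxLoT_add_origin hv R' k ha]
  have hkN : (k : ℤ) ≤ N := by exact_mod_cast hk
  have hk0 : (0 : ℤ) ≤ k := by positivity
  have hR : (0 : ℤ) ≤ R' := by positivity
  nlinarith

/-- **`hclrM` from the v-free bridge floor** (hop side `s_h = −1`, i.e. `v ≤ 0`): `M + n + (N+1)·R′ < c_lo` gives
`yBoxHiT k + σ·yL 0 < −M` for every `k ≤ N`. [cite: KozmaNitzan2024, §4 Lemma 11 (p. 22)] -/
theorem hclrM_of_clearF {n : ℕ} {v : ℤ} (hv : |v| ≤ n) (hv0 : v ≤ 0) (R' N : ℕ) {clo a M : ℤ} (ha : a = -(clo + n) + v)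
    (hF : M + n + ((N : ℤ) + 1) * R' < clo) : ∀ k ≤ N, yBoxHiT n v R' k + a < -M := by
  intro k hk
  rw [yBoxHiT_add_origin hv R' k ha]
  have hkN : (k : ℤ) ≤ N := by exact_mod_cast hk
  have hk0 : (0 : ℤ) ≤ k := by positivity
  have hR : (0 : ℤ) ≤ R' := by positivity
  nlinarith

end Skelφ

end Summit.CriticalPhenomena.PercolationContinuityZ3.Theorems.Transplant
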